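import Literature.IUT.LogVolume.TensorPacketLogStar
import Literature.IUT.LogVolume.DifferentEstimatesCorollaries
import HarnessLib

/-!
# [IUTchIV] Prop. 1.2 (ii), STAR FORM, with an EXACT INNER RADIUS: `ι_i(g)·(R_I)^∼ ⊆ p^{⌊λ − d_{I∖{*}} − Σ_a r_a⌋}·log_p(R_I^×)`
# whenever every factor shell contains the ball `{‖y‖ ≤ p^{−r_a}}`

Mochizuki, *Inter-universal Teichmüller theory IV*, RIMS manuscript (Apr. 2020), §1, Prop. 1.1 (p. 9) and Prop. 1.2 (i)(ii)
(p. 10, proof p. 11). PROOF-ONLY companion (abc-iut cell, branch D seat abc-iut-D1-prv, gen 4; D-0079 R-W row «W:T1½ TAME-BOUNDARY»)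
of abc-iut-w4-d006's `TensorPacketLogStar.lean` (the STAR form with the [IUTchIV] Prop. 1.2 (i) container `p^{a_i}·R_i ⊆ log_p(R_i^×)`).

THE POINT. The printed chain of p. 11 — and the tree's `purePacket_smul_normalizedPacket_subset_ppow_smul_logPacket_of_star` — pays,
at every slot `a`, the exponent `a_a = ⌈e_a/(p−2)⌉/e_a` of the GENERIC lower container `p^{a_a}·R_a ⊆ log_p(R_a^×)` of Prop. 1.2 (i).
That container is EXACT at tame places (`e_a ≤ p − 2`: `log_p(R_a^×) = 𝔪_a = p^{1/e_a}·R_a`) but NOT at the tame BOUNDARY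
`e_a = p − 1`: there `a_a = 2/e_a` although, when `R_a` has no non-trivial `p`-th root of unity, still `log_p(R_a^×) = 𝔪_a`
(tree: `logUnits_eq_closedBall_of_forall_pow_prime_eq_one`, `TorsionFree.logUnits_eq_closedBall_of_le_pred`). Here the same chain is
run with an ARBITRARY certified inner radius per slot — a family `α_a ≠ 0` with `{‖y‖ ≤ ‖α_a‖} ⊆ log_p(R_a^×)` — in place of the
elements of order `a_a`:

* `purePacket_mul_mem_logPacket_of_closedBall_subset` — `(⊗α_a)·R_I ⊆ log_p(R_I^×)`;
* `purePacket_smul_normalizedPacket_subset_ppow_smul_logPacket_of_star_of_inner` — for nonzero `c_a` with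
  `∏‖c_a‖ ≤ p^{−(n + (d_I − d_*))}·∏‖α_a‖`: `(⊗c_a)·(R_I)^∼ ⊆ p^n·log_p(R_I^×)`;
* **`iota_smul_normalizedPacket_subset_zpow_smul_logPacket_of_star_of_inner`** — for `‖g‖ = p^{−m/e_i}` and `‖α_a‖ = p^{−r_a}`:
  `ι_i(g)·(R_I)^∼ ⊆ p^{⌊m/e_i − (d_I − d_*) − Σ_a r_a⌋}·log_p(R_I^×)`;
* `floor_star_inner_of_not_dvd` — at a tuple of TAMELY RAMIFIED factors (`p ∤ e_a`, so `d_a = (e_a − 1)/e_a`, Serre III §6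
  Prop. 13) with the uniformizer radii `r_a = 1/e_a`: `⌊m/e_* − (d_I − d_*) − Σ_a 1/e_a⌋ = (m − 1) div e_* + 1 − |I|` — the SAME
  closed form as the tame one (`floor_star_of_tame'`), now valid up to the boundary `e_a = p − 1`.

Consequence for the cell (sequel `Summits/ABC/IUTFork/Cor312LicenceTameBoundary.lean`): at places with `e ≤ p − 1` and no
non-trivial `p`-th root of unity the per-packet (xi-f) dichotomy of the tame case holds VERBATIM (D-0079 R-W stratum U1½).
Classical local algebra throughout; the [IUTchIV] locators record where the cell uses it.
[cite: Mochizuki2012, IUTchIV Prop. 1.1 p. 9, Prop. 1.2 (i)(ii) pp. 10–11] [cite: SerreLocalFields1979, Ch. III §6 Prop. 13]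
No side taken on [IUTchIII] Cor. 3.12 [claim: Mochizuki2012, status: disputed]. PROOF-ONLY file: no definitions, no named `Prop`
facts, no `sorry`.
-/

noncomputable section

open Metric Set
open scoped Pointwise TensorProduct NormedField

namespace Literature.IUT.LogVolume

variable (p : ℕ) [Fact p.Prime]
variable {I : Type} [Fintype I] [DecidableEq I]
variable (k : I → Type) [∀ i, NontriviallyNormedField (k i)] [∀ i, NormedAlgebra ℚ_[p] (k i)]
  [∀ i, IsUltrametricDist (k i)] [∀ i, ProperSpace (k i)]

/-! ## `(⊗α_a)·R_I ⊆ log_p(R_I^×)` for a certified inner radius -/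

omit [Fintype I] [DecidableEq I] [∀ i, IsUltrametricDist (k i)] [∀ i, ProperSpace (k i)] in
/-- **`(⊗α_a)·R_I ⊆ log_p(R_I^×)` whenever `{‖y‖ ≤ ‖α_a‖} ⊆ log_p(R_a^×)` at every slot** (the third inclusion of [IUTchIV] p. 11
with the generic `p^{a_a}·R_a` replaced by any ball known to lie in the factor shell): on pure tensors of integers
`(⊗α_a)(⊗x_a) = ⊗(α_a x_a)` with `‖α_a x_a‖ ≤ ‖α_a‖`; then additivity. [cite: Mochizuki2012, IUTchIV Prop. 1.2 (i)(ii) pp. 10–11] -/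
theorem purePacket_mul_mem_logPacket_of_closedBall_subset {α : Π i, k i}
    (hα : ∀ i, closedBall (0 : k i) ‖α i‖ ⊆ logUnits (k i))
    {r : PacketAlgebra p k} (hr : r ∈ integerPacket p k) :
    purePacket p k α * r ∈ logPacket p k := by
  refine integerPacket_induction p k (C := fun t ↦ purePacket p k α * t ∈ logPacket p k)
    ?_ ?_ ?_ ?_ hr
  · intro x hx
    rw [purePacket_mul]
    refine AddSubgroup.subset_closure ⟨α * x, fun i ↦ hα i ?_, rfl⟩
    rw [mem_closedBall, dist_zero_right, Pi.mul_apply, norm_mul]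
    calc ‖α i‖ * ‖x i‖ ≤ ‖α i‖ * 1 := by gcongr; exact hx i
      _ = ‖α i‖ := mul_one _
  · rw [mul_zero]; exact zero_mem _
  · intro a b ha hb; rw [mul_add]; exact add_mem ha hb
  · intro a ha; rw [mul_neg]; exact neg_mem ha

/-! ## The chain of p. 11 with `δ_* = 1` and the certified inner radius -/

/-- **The chain of [IUTchIV] p. 11 paying only `d_{I∖{*}}` and an EXACT inner radius.** For a slot `*`, nonzero `c_a`, a family
`α_a ≠ 0` with `{‖y‖ ≤ ‖α_a‖} ⊆ log_p(R_a^×)`, and `n ∈ ℤ` with `∏‖c_a‖ ≤ p^{−(n + (d_I − d_*))}·∏‖α_a‖`: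
`(⊗c_a)·(R_I)^∼ ⊆ p^n·log_p(R_I^×)`. Proof as in `purePacket_smul_normalizedPacket_subset_ppow_smul_logPacket_of_star`
(abc-iut-w4-d006), the elements of order `a_a` replaced by the `α_a`: `⊗c_a = (⊗ c_a δ_a⁻¹ α_a⁻¹)·(⊗δ_a)·(⊗α_a)`, `δ_* = 1`; the first
factor is `p^n·y`, `y ∈ (R_I)^∼`; `(⊗δ_a)·(R_I)^∼ ⊆ R_I` (Prop. 1.1, `purePacket_mul_mem_integerPacket`); `(⊗α_a)·R_I ⊆ log_p(R_I^×)`.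
[cite: Mochizuki2012, IUTchIV Prop. 1.1 p. 9, Prop. 1.2 (ii) p. 11] -/
theorem purePacket_smul_normalizedPacket_subset_ppow_smul_logPacket_of_star_of_inner (star : I) {c : Π i, k i}
    (hc : ∀ i, c i ≠ 0) {α : Π i, k i} (hα0 : ∀ i, α i ≠ 0)
    (hα : ∀ i, closedBall (0 : k i) ‖α i‖ ⊆ logUnits (k i)) {n : ℤ}
    (hn : ∏ i, ‖c i‖ ≤ (p : ℝ) ^ (-((n : ℝ) + (dSum p k - differentOrd p (k star)))) * ∏ i, ‖α i‖) :
    purePacket p k c • (normalizedPacket p k : Set (PacketAlgebra p k)) ⊆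
      ppow p k n • (logPacket p k : Set (PacketAlgebra p k)) := by
  haveI : Nonempty I := ⟨star⟩
  have hp0 : (0 : ℝ) < p := by exact_mod_cast (Fact.out : p.Prime).pos
  -- generators of the differents off `*`, `1` at `*`
  choose δ₀ hδ₀ using fun i ↦ exists_different_eq_span p (k i)
  let δ : Π i, Valued.integer (k i) := Function.update δ₀ star 1
  have hδstar : δ star = 1 := Function.update_self ..
  have hδne : ∀ i, i ≠ star → δ i = δ₀ i := fun i hi ↦ Function.update_of_ne hi ..
  have hδgen : ∀ i, i ≠ star → different p (k i) = Ideal.span {δ i} := fun i hi ↦ by rw [hδne i hi]; exact hδ₀ i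
  -- norms: `‖δ_a‖ = p^{−d_a}` off `*`, `‖δ_*‖ = 1 = p^0`
  let dδ : I → ℝ := fun i ↦ if i = star then 0 else differentOrd p (k i)
  have hδn : ∀ i, ‖(δ i : k i)‖ = (p : ℝ) ^ (-dδ i) := by
    intro i
    by_cases hi : i = star
    · subst hi
      simp only [dδ, if_pos rfl, neg_zero, Real.rpow_zero, hδstar, OneMemClass.coe_one, norm_one]
    · simp only [dδ, if_neg hi, hδne i hi]
      exact (norm_generator_different p (k i) (hδ₀ i)).2
  have hδ0 : ∀ i, (δ i : k i) ≠ 0 := fun i ↦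
    norm_pos_iff.mp (by rw [hδn i]; positivity)
  have hsumδ : ∑ i, dδ i = dSum p k - differentOrd p (k star) := by
    simp only [dδ]
    rw [Finset.sum_ite, Finset.sum_const_zero, zero_add, dSum, Finset.filter_ne' Finset.univ star,
      Finset.sum_erase_eq_sub (Finset.mem_univ star)]
  have hdα0 : ∀ i, (δ i : k i) * α i ≠ 0 := fun i ↦ mul_ne_zero (hδ0 i) (hα0 i)
  have hαpos : 0 < ∏ i, ‖α i‖ := Finset.prod_pos fun i _ ↦ norm_pos_iff.mpr (hα0 i)
  -- the quotient tensor `⊗ c_a/(δ_a α_a)` has `∏ ‖·‖ ≤ p^{−n}`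
  have hG : ∏ i, ‖c i / ((δ i : k i) * α i)‖ ≤ (p : ℝ) ^ (-(n : ℝ)) := by
    have e1 : ∏ i, ‖c i / ((δ i : k i) * α i)‖ =
        (∏ i, ‖c i‖) / ((p : ℝ) ^ (-(dSum p k - differentOrd p (k star))) * ∏ i, ‖α i‖) := by
      simp_rw [norm_div, norm_mul, Finset.prod_div_distrib, Finset.prod_mul_distrib]
      rw [prod_norm_eq_rpow_neg_sum p k hδn, hsumδ]
    rw [e1, div_le_iff₀ (by positivity)]
    calc ∏ i, ‖c i‖ ≤ (p : ℝ) ^ (-((n : ℝ) + (dSum p k - differentOrd p (k star)))) * ∏ i, ‖α i‖ := hn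
      _ = (p : ℝ) ^ (-(n : ℝ)) * ((p : ℝ) ^ (-(dSum p k - differentOrd p (k star))) * ∏ i, ‖α i‖) := by
        rw [← mul_assoc, ← Real.rpow_add hp0]
        congr 2
        ring
  obtain ⟨y, hy, hGy⟩ := exists_eq_ppow_mul_of_prod_norm_le p k (fun i ↦ div_ne_zero (hc i) (hdα0 i)) hG
  have hc_eq : purePacket p k c =
      ppow p k n * y * purePacket p k (fun i ↦ (δ i : k i)) * purePacket p k α := by
    rw [← hGy, purePacket_mul, purePacket_mul]
    congr 1
    funext i
    simp only [Pi.mul_apply]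
    rw [mul_assoc, div_mul_cancel₀ _ (hdα0 i)]
  rintro _ ⟨x, hx, rfl⟩
  have hyx : y * x ∈ normalizedPacket p k := mul_mem hy hx
  have hr := purePacket_mul_mem_integerPacket p k star δ hδgen hδstar hyx
  have hw := purePacket_mul_mem_logPacket_of_closedBall_subset p k hα hr
  refine ⟨_, hw, ?_⟩
  simp only [smul_eq_mul, hc_eq]
  ring

/-! ## Prop. 1.2 (ii), first inclusion, star form, certified inner radius -/

/-- **[IUTchIV] Prop. 1.2 (ii), first inclusion, STAR FORM, EXACT INNER RADIUS, at `φ = id`.** For ANY slots `*` and `i`, `‖g‖ = p^{−m/e_i}`,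
and a family `α_a ≠ 0` with `{‖y‖ ≤ ‖α_a‖} ⊆ log_p(R_a^×)` and `‖α_a‖ = p^{−r_a}`:
`ι_i(g)·(R_I)^∼ ⊆ p^{⌊m/e_i − (d_I − d_*) − Σ_a r_a⌋}·log_p(R_I^×)`. With `r_a = a_a` this is abc-iut-w4-d006's
`iota_smul_normalizedPacket_subset_zpow_smul_logPacket_of_star`. [cite: Mochizuki2012, IUTchIV Prop. 1.1 p. 9, Prop. 1.2 (ii) p. 10] -/
theorem iota_smul_normalizedPacket_subset_zpow_smul_logPacket_of_star_of_inner (star i : I) {m : ℤ} {g : k i}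
    (hg : ‖g‖ = (p : ℝ) ^ (-((m : ℝ) / absRamificationIdx p (k i))))
    {α : Π i, k i} (hα : ∀ j, closedBall (0 : k j) ‖α j‖ ⊆ logUnits (k j)) {r : I → ℝ}
    (hαr : ∀ j, ‖α j‖ = (p : ℝ) ^ (-r j)) :
    iota p k i g • (normalizedPacket p k : Set (PacketAlgebra p k)) ⊆
      ((p : ℚ_[p]) ^ ⌊(m : ℝ) / absRamificationIdx p (k i) - (dSum p k - differentOrd p (k star)) - ∑ j, r j⌋) •
        (logPacket p k : Set (PacketAlgebra p k)) := by
  haveI : Nonempty I := ⟨star⟩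
  have hp0 : (0 : ℝ) < p := by exact_mod_cast (Fact.out : p.Prime).pos
  have hp1 : (1 : ℝ) < p := by exact_mod_cast (Fact.out : p.Prime).one_lt
  set n : ℤ := ⌊(m : ℝ) / absRamificationIdx p (k i) - (dSum p k - differentOrd p (k star)) - ∑ j, r j⌋ with hn_def
  have hg0 : g ≠ 0 := norm_pos_iff.mp (by rw [hg]; positivity)
  have hα0 : ∀ j, α j ≠ 0 := fun j ↦ norm_pos_iff.mp (by rw [hαr j]; positivity)
  rw [← ppow_smul_set_eq, iota_eq_purePacket]
  refine purePacket_smul_normalizedPacket_subset_ppow_smul_logPacket_of_star_of_inner p k star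
    (fun j ↦ mulSingle_ne_zero k hg0 j) hα0 hα ?_
  rw [prod_norm_mulSingle k i g, hg, prod_norm_eq_rpow_neg_sum p k hαr, ← Real.rpow_add hp0]
  refine Real.rpow_le_rpow_of_exponent_le hp1.le ?_
  have := Int.floor_le ((m : ℝ) / absRamificationIdx p (k i) - (dSum p k - differentOrd p (k star)) - ∑ j, r j)
  linarith

/-! ## Evaluation at a tuple of tamely ramified factors with the uniformizer radii `r_a = 1/e_a` -/

section TamelyRamified

variable (hnd : ∀ i, ¬ p ∣ absRamificationIdx p (k i))
include hnd

omit [DecidableEq I] in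
/-- At a tuple of TAMELY RAMIFIED factors (`p ∤ e_a`, so `d_a = (e_a − 1)/e_a`, Serre III §6 Prop. 13) with the radii `r_a = 1/e_a`:
`x − (d_I − d_*) − Σ_a 1/e_a = x + 1 − 1/e_* − |I|` — the tame value of `sub_dSum_sub_differentOrd_sub_aSum_of_tame`, now without
any bound on the `e_a` beyond `p ∤ e_a`. [cite: SerreLocalFields1979, Ch. III §6 Prop. 13] [cite: Mochizuki2012, IUTchIV Prop. 1.1 p. 9] -/
theorem sub_dSum_sub_differentOrd_sub_sum_inv_of_not_dvd (star : I) (x : ℝ) :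
    x - (dSum p k - differentOrd p (k star)) - ∑ j, 1 / (absRamificationIdx p (k j) : ℝ) =
      x + 1 - 1 / (absRamificationIdx p (k star) : ℝ) - Fintype.card I := by
  have hd : ∀ j, differentOrd p (k j) = 1 - 1 / (absRamificationIdx p (k j) : ℝ) := by
    intro j
    have he0 : (absRamificationIdx p (k j) : ℝ) ≠ 0 := by exact_mod_cast (absRamificationIdx_pos p (k j)).ne'
    rw [differentOrd_eq_of_not_dvd p (k j) (hnd j)]
    field_simp
  have hsum : dSum p k = Fintype.card I - ∑ j, 1 / (absRamificationIdx p (k j) : ℝ) := by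
    rw [dSum, Finset.sum_congr rfl fun j _ => hd j, Finset.sum_sub_distrib, Finset.sum_const, Finset.card_univ,
      nsmul_eq_mul, mul_one]
  rw [hsum, hd star]
  ring

omit [DecidableEq I] in
/-- **Closed form of the star exponent with the uniformizer inner radii at a tamely ramified tuple**:
`⌊m/e_* − (d_I − d_*) − Σ_a 1/e_a⌋ = (m − 1) div e_* + 1 − |I|` — literally the tame closed form `floor_star_of_tame'`
(abc-iut-w4-d006), valid whenever `p ∤ e_a` at every slot (in particular at the tame boundary `e_a = p − 1`).
[cite: Mochizuki2012, IUTchIV Prop. 1.2 (ii) p. 10] [cite: SerreLocalFields1979, Ch. III §6 Prop. 13] -/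
theorem floor_star_inner_of_not_dvd (star : I) (m : ℤ) :
    ⌊(m : ℝ) / absRamificationIdx p (k star) - (dSum p k - differentOrd p (k star)) -
        ∑ j, 1 / (absRamificationIdx p (k j) : ℝ)⌋ =
      (m - 1) / (absRamificationIdx p (k star) : ℤ) + 1 - Fintype.card I := by
  set e : ℕ := absRamificationIdx p (k star) with he_def
  have he0 : 0 < e := absRamificationIdx_pos p (k star)
  have heR : (e : ℝ) ≠ 0 := by exact_mod_cast he0.ne'
  have heZ : (0 : ℤ) < (e : ℤ) := by exact_mod_cast he0
  rw [sub_dSum_sub_differentOrd_sub_sum_inv_of_not_dvd p k hnd star, Int.floor_sub_natCast]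
  have : (m : ℝ) / e + 1 - 1 / (e : ℝ) = (((m - 1) + e : ℤ) : ℝ) / (e : ℝ) := by
    push_cast
    field_simp
    ring
  rw [this, Int.floor_div_natCast, Int.floor_intCast, Int.add_ediv_of_dvd_right (dvd_refl _), Int.ediv_self heZ.ne']

end TamelyRamified

end Literature.IUT.LogVolume

end
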